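import Mathlib
import HarnessLib
import Literature.Computability.Complexity.CNF
import Literature.Computability.Complexity.PNPWave0

/-!
# PneNP / OverlapGapAlgebra — `SearchHardWindow`: the unconditional query rung

Support for crux `stmt-PneNP-2460` (`Summit.PneNP.PneNP.Theses.OverlapGapAlgebra.SearchHardWindow`),
whose hardness conjunct asks that every polynomial-time `f` (input `encodingCNF` of the clause
list of `Φ : Fin m → Fin k → Fin n × Bool`, output word read as an assignment via `List.getD`)
solve `F_k(n, ⌊αn⌋)` with probability `→ 0`. Here that conjunct is proved UNCONDITIONALLY (no
complexity hypothesis, no citation, every `k` and `α`) for all solvers that do not read the whole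
formula, adaptively: `shwQ_card_solved_le` — if `U Φ` is a self-consistent set of unread clause
positions (changing `Φ` on `U Φ` changes neither the output `A Φ` nor `U Φ`: the leaf of a
clause-probing decision tree; constant `U` = non-adaptive) with `|U Φ| ≥ s`, then
`#{Φ : A Φ ⊨ Φ} ≤ (1 - 2^{-k})^s · #instances` (cylinders `{Ψ = Φ off U Φ}` partition instance
space, `A` is constant on each, and a free clause is satisfied by a fixed `σ` with probability
exactly `1 - 2^{-k}`, `shwQ_card_satClauses`); `shwQ_unread_le_of_success` — success `≥ ε` forces
`s ≤ 2^k log(1/ε)`; `shwQ_hardnessConjunct_of_unread` — `s n → ∞` unread clauses ⟹ the crux's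
hardness conjunct for `f` verbatim; corollaries `…_of_nonadaptive`, `…_of_oblivious` (constant `f`).
Rung 0 of the ladder of solver classes for which the conjunct is a theorem (the AC⁰ / low-degree
rungs of line `Sketch` sit above it, conditional on Huang–Sellke 2025); it isolates adaptive full
reading as necessary for success and does not touch the polynomial-time kernel.
No new definitions; axioms `propext`, `Classical.choice`, `Quot.sound`.
-/

set_option linter.dupNamespace false -- `Summit.PneNP.PneNP.…`: summit = sub-problem (D-0017)

namespace Summit.PneNP.PneNP.Theorems

open Finset Filter
open scoped Classical

section Count

variable {m k n : ℕ}

/-- Literals false under a fixed assignment `σ`: exactly `n` of the `2n` literals. [folklore] -/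
theorem shwQ_card_falseLits (σ : Fin n → Bool) :
    ((univ : Finset (Fin n × Bool)).filter fun ℓ => σ ℓ.1 ≠ ℓ.2).card = n := by
  have h : ((univ : Finset (Fin n × Bool)).filter fun ℓ => σ ℓ.1 ≠ ℓ.2)
      = (univ : Finset (Fin n)).image fun v => (v, !σ v) := by
    ext ⟨v, b⟩
    simp only [mem_filter, mem_univ, true_and, Finset.mem_image, Prod.mk.injEq]
    constructor
    · intro hb
      refine ⟨v, rfl, ?_⟩
      cases h' : σ v <;> cases b <;> simp_all
    · rintro ⟨w, rfl, hw⟩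
      rw [← hw]
      cases σ w <;> simp
  have hinj : Function.Injective fun v : Fin n => (v, !σ v) :=
    fun v w hvw => (Prod.mk.injEq _ _ _ _ ▸ hvw).1
  rw [h, card_image_of_injective _ hinj, card_univ, Fintype.card_fin]

/-- Clauses satisfied by a fixed assignment `σ` (some literal true): `(2n)^k - n^k` of the `(2n)^k`
clauses — the complement is the box of all-false clauses. [folklore] -/
theorem shwQ_card_satClauses (σ : Fin n → Bool) :
    ((univ : Finset (Fin k → Fin n × Bool)).filter fun cl => ∃ j, σ (cl j).1 = (cl j).2).card
      = (2 * n) ^ k - n ^ k := by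
  have hunsat : ((univ : Finset (Fin k → Fin n × Bool)).filter
      fun cl => ¬ ∃ j, σ (cl j).1 = (cl j).2).card = n ^ k := by
    have h : ((univ : Finset (Fin k → Fin n × Bool)).filter fun cl => ¬ ∃ j, σ (cl j).1 = (cl j).2)
        = Fintype.piFinset fun _ : Fin k =>
            (univ : Finset (Fin n × Bool)).filter fun ℓ => σ ℓ.1 ≠ ℓ.2 := by
      ext cl
      simp [Fintype.mem_piFinset]
    rw [h, Fintype.card_piFinset_const, shwQ_card_falseLits]
  have hsplit := Finset.card_filter_add_card_filter_not
    (s := (univ : Finset (Fin k → Fin n × Bool))) (fun cl => ∃ j, σ (cl j).1 = (cl j).2)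
  rw [hunsat, card_univ, Fintype.card_fun, Fintype.card_prod, Fintype.card_fin, Fintype.card_fin,
    Fintype.card_bool] at hsplit
  rw [show 2 * n = n * 2 by ring]
  omega

/-- The cylinder of instances agreeing with `Φ` outside the clause positions `T` is a box. -/
theorem shwQ_cylinder_eq_piFinset (T : Finset (Fin m)) (Φ : Fin m → Fin k → Fin n × Bool) :
    ((univ : Finset (Fin m → Fin k → Fin n × Bool)).filter fun Ψ => ∀ i ∉ T, Ψ i = Φ i)
      = Fintype.piFinset fun i => if i ∈ T then univ else {Φ i} := by
  ext Ψ
  simp only [mem_filter, mem_univ, true_and, Fintype.mem_piFinset]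
  constructor
  · intro h i
    split_ifs with hi
    · exact mem_univ _
    · exact mem_singleton.2 (h i hi)
  · intro h i hi
    have := h i
    rw [if_neg hi] at this
    exact mem_singleton.1 this

/-- A cylinder with `|T|` free clause positions has `((2n)^k)^{|T|}` points. -/
theorem shwQ_card_cylinder (T : Finset (Fin m)) (Φ : Fin m → Fin k → Fin n × Bool) :
    ((univ : Finset (Fin m → Fin k → Fin n × Bool)).filter fun Ψ => ∀ i ∉ T, Ψ i = Φ i).card
      = ((2 * n) ^ k) ^ T.card := by
  rw [shwQ_cylinder_eq_piFinset, Fintype.card_piFinset]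
  have h : ∀ i : Fin m, (if i ∈ T then (univ : Finset (Fin k → Fin n × Bool)) else {Φ i}).card
      = if i ∈ T then (2 * n) ^ k else 1 := by
    intro i
    split_ifs
    · rw [card_univ, Fintype.card_fun, Fintype.card_prod, Fintype.card_fin, Fintype.card_fin,
        Fintype.card_bool, mul_comm]
    · rfl
  simp_rw [h]
  rw [Finset.prod_ite_mem, univ_inter, prod_const]

/-- Inside a cylinder, the instances whose free clauses are all satisfied by a FIXED assignment `σ`
form a box with `((2n)^k - n^k)^{|T|}` points. -/
theorem shwQ_card_cylinder_satBy (T : Finset (Fin m)) (Φ : Fin m → Fin k → Fin n × Bool)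
    (σ : Fin n → Bool) :
    ((univ : Finset (Fin m → Fin k → Fin n × Bool)).filter fun Ψ =>
        (∀ i ∉ T, Ψ i = Φ i) ∧ ∀ i ∈ T, ∃ j, σ (Ψ i j).1 = (Ψ i j).2).card
      = ((2 * n) ^ k - n ^ k) ^ T.card := by
  have hbox : ((univ : Finset (Fin m → Fin k → Fin n × Bool)).filter fun Ψ =>
        (∀ i ∉ T, Ψ i = Φ i) ∧ ∀ i ∈ T, ∃ j, σ (Ψ i j).1 = (Ψ i j).2)
      = Fintype.piFinset fun i => if i ∈ T then
          (univ : Finset (Fin k → Fin n × Bool)).filter fun cl => ∃ j, σ (cl j).1 = (cl j).2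
        else {Φ i} := by
    ext Ψ
    simp only [mem_filter, mem_univ, true_and, Fintype.mem_piFinset]
    constructor
    · rintro ⟨h₁, h₂⟩ i
      split_ifs with hi
      · exact mem_filter.2 ⟨mem_univ _, h₂ i hi⟩
      · exact mem_singleton.2 (h₁ i hi)
    · intro h
      refine ⟨fun i hi => ?_, fun i hi => ?_⟩
      · have := h i
        rw [if_neg hi] at this
        exact mem_singleton.1 this
      · have := h i
        rw [if_pos hi] at this
        exact (mem_filter.1 this).2
  rw [hbox, Fintype.card_piFinset]
  have h : ∀ i : Fin m, (if i ∈ T then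
        (univ : Finset (Fin k → Fin n × Bool)).filter (fun cl => ∃ j, σ (cl j).1 = (cl j).2)
      else {Φ i}).card = if i ∈ T then (2 * n) ^ k - n ^ k else 1 := by
    intro i
    split_ifs
    · exact shwQ_card_satClauses σ
    · rfl
  simp_rw [h]
  rw [Finset.prod_ite_mem, univ_inter, prod_const]

end Count

section Adaptive

variable {m k n : ℕ}

/-- **The query rung, counting form.** Let `A` map instances to assignments and let `U Φ` be a set
of "unread" clause positions, self-consistently: changing `Φ` on `U Φ` changes neither the output
`A Φ` nor the set `U Φ` (this is what the leaf of an adaptive clause-probing decision tree provides: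
`U Φ` = the clauses not probed on the root-to-leaf path of `Φ`; a constant `U` is the non-adaptive
case). If always `|U Φ| ≥ s`, then `A` solves at most `(1 - 2^{-k})^s · #instances` instances. -/
theorem shwQ_card_solved_le
    (A : (Fin m → Fin k → Fin n × Bool) → (Fin n → Bool))
    (U : (Fin m → Fin k → Fin n × Bool) → Finset (Fin m)) (s : ℕ)
    (hU : ∀ Φ Ψ : Fin m → Fin k → Fin n × Bool, (∀ i ∉ U Φ, Ψ i = Φ i) → A Ψ = A Φ ∧ U Ψ = U Φ)
    (hs : ∀ Φ, s ≤ (U Φ).card) :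
    (((univ : Finset (Fin m → Fin k → Fin n × Bool)).filter fun Φ =>
        ∀ i, ∃ j, A Φ (Φ i j).1 = (Φ i j).2).card : ℝ)
      ≤ (1 - (1 / 2 : ℝ) ^ k) ^ s * Fintype.card (Fin m → Fin k → Fin n × Bool) := by
  -- the cylinder through `Φ`
  set cyl : (Fin m → Fin k → Fin n × Bool) → Finset (Fin m → Fin k → Fin n × Bool) :=
    fun Φ => univ.filter fun Ψ => ∀ i ∉ U Φ, Ψ i = Φ i with hcyl
  have mem_cyl : ∀ Φ Ψ, Ψ ∈ cyl Φ ↔ ∀ i ∉ U Φ, Ψ i = Φ i := fun Φ Ψ => by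
    simp [hcyl]
  have self_mem : ∀ Φ, Φ ∈ cyl Φ := fun Φ => (mem_cyl Φ Φ).2 fun _ _ => rfl
  -- cylinders are the fibres of `cyl`
  have cyl_eq_of_mem : ∀ Φ Ψ, Ψ ∈ cyl Φ → cyl Ψ = cyl Φ := by
    intro Φ Ψ hΨ
    rw [mem_cyl] at hΨ
    have hUeq : U Ψ = U Φ := (hU Φ Ψ hΨ).2
    ext Θ
    rw [mem_cyl, mem_cyl, hUeq]
    constructor
    · intro h i hi; rw [h i hi, hΨ i hi]
    · intro h i hi; rw [h i hi, hΨ i hi]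
  have fiber_eq : ∀ Φ, (univ.filter fun Ψ => cyl Ψ = cyl Φ) = cyl Φ := by
    intro Φ
    ext Ψ
    simp only [mem_filter, mem_univ, true_and]
    exact ⟨fun h => h ▸ self_mem Ψ, cyl_eq_of_mem Φ Ψ⟩
  -- sizes
  have card_cyl : ∀ Φ, (cyl Φ).card = ((2 * n) ^ k) ^ (U Φ).card := fun Φ =>
    shwQ_card_cylinder (U Φ) Φ
  have hq : (2 * n : ℝ) ^ k - (n : ℝ) ^ k = (1 - (1 / 2 : ℝ) ^ k) * (2 * n : ℝ) ^ k := by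
    rw [mul_pow, one_div, inv_pow]
    have : (2 : ℝ) ^ k ≠ 0 := by positivity
    field_simp
  have hr0 : (0 : ℝ) ≤ 1 - (1 / 2 : ℝ) ^ k :=
    sub_nonneg.2 (pow_le_one₀ (by norm_num) (by norm_num))
  have hr1 : 1 - (1 / 2 : ℝ) ^ k ≤ 1 := sub_le_self _ (by positivity)
  -- per-cylinder bound
  set G : Finset (Fin m → Fin k → Fin n × Bool) :=
    univ.filter fun Φ => ∀ i, ∃ j, A Φ (Φ i j).1 = (Φ i j).2 with hG
  have per_cyl : ∀ Φ, ((G.filter fun Ψ => cyl Ψ = cyl Φ).card : ℝ)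
      ≤ (1 - (1 / 2 : ℝ) ^ k) ^ s * (cyl Φ).card := by
    intro Φ
    have hsub : (G.filter fun Ψ => cyl Ψ = cyl Φ) ⊆
        univ.filter fun Ψ => (∀ i ∉ U Φ, Ψ i = Φ i) ∧ ∀ i ∈ U Φ, ∃ j, A Φ (Ψ i j).1 = (Ψ i j).2 := by
      intro Ψ hΨ
      rw [mem_filter] at hΨ
      obtain ⟨hΨG, hΨc⟩ := hΨ
      have hmem : Ψ ∈ cyl Φ := hΨc ▸ self_mem Ψ
      rw [mem_cyl] at hmem
      rw [hG, mem_filter] at hΨG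
      have hA : A Ψ = A Φ := (hU Φ Ψ hmem).1
      refine mem_filter.2 ⟨mem_univ _, hmem, fun i _ => ?_⟩
      rw [← hA]
      exact hΨG.2 i
    have h1 : ((G.filter fun Ψ => cyl Ψ = cyl Φ).card : ℝ)
        ≤ ((2 * n : ℝ) ^ k - (n : ℝ) ^ k) ^ (U Φ).card := by
      have hle : n ^ k ≤ (2 * n) ^ k := Nat.pow_le_pow_left (by omega) k
      have := (Nat.cast_le (α := ℝ)).2
        ((card_le_card hsub).trans_eq (shwQ_card_cylinder_satBy (U Φ) Φ (A Φ)))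
      push_cast [Nat.cast_sub hle] at this
      exact this
    have hcast : ((cyl Φ).card : ℝ) = ((2 * n : ℝ) ^ k) ^ (U Φ).card := by
      exact_mod_cast card_cyl Φ
    rw [hcast]
    calc ((G.filter fun Ψ => cyl Ψ = cyl Φ).card : ℝ)
          ≤ ((2 * n : ℝ) ^ k - (n : ℝ) ^ k) ^ (U Φ).card := h1
      _ = (1 - (1 / 2 : ℝ) ^ k) ^ (U Φ).card * ((2 * n : ℝ) ^ k) ^ (U Φ).card := by
          rw [hq, mul_pow]
      _ ≤ (1 - (1 / 2 : ℝ) ^ k) ^ s * ((2 * n : ℝ) ^ k) ^ (U Φ).card :=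
          mul_le_mul_of_nonneg_right (pow_le_pow_of_le_one hr0 hr1 (hs Φ)) (by positivity)
  -- sum over the fibres
  have hGsum := Finset.card_eq_sum_card_image cyl G
  have hUsum := Finset.card_eq_sum_card_image cyl (univ : Finset (Fin m → Fin k → Fin n × Bool))
  have himage : G.image cyl ⊆ univ.image cyl := image_subset_image (subset_univ _)
  calc ((G.card : ℕ) : ℝ) = ∑ D ∈ G.image cyl, ((G.filter fun Ψ => cyl Ψ = D).card : ℝ) := by
        rw [hGsum]; push_cast; rfl
    _ ≤ ∑ D ∈ univ.image cyl, ((G.filter fun Ψ => cyl Ψ = D).card : ℝ) :=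
        sum_le_sum_of_subset_of_nonneg himage fun _ _ _ => by positivity
    _ ≤ ∑ D ∈ univ.image cyl, (1 - (1 / 2 : ℝ) ^ k) ^ s *
          ((univ.filter fun Ψ : Fin m → Fin k → Fin n × Bool => cyl Ψ = D).card : ℝ) := by
        refine sum_le_sum fun D hD => ?_
        obtain ⟨Φ, -, rfl⟩ := mem_image.1 hD
        rw [fiber_eq Φ]
        exact per_cyl Φ
    _ = (1 - (1 / 2 : ℝ) ^ k) ^ s * Fintype.card (Fin m → Fin k → Fin n × Bool) := by
        rw [← mul_sum, ← card_univ, hUsum]; push_cast; rfl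

/-- **Quantitative contrapositive.** If such a solver succeeds on at least an `ε`-fraction of the
instances (`ε > 0`, `n ≥ 1`), then `s ≤ 2^k · log (1/ε)`: success with probability `ε` requires
reading all but at most `2^k log(1/ε)` clauses, uniformly in `n` and `m`. -/
theorem shwQ_unread_le_of_success (hn : 1 ≤ n)
    (A : (Fin m → Fin k → Fin n × Bool) → (Fin n → Bool))
    (U : (Fin m → Fin k → Fin n × Bool) → Finset (Fin m)) (s : ℕ)
    (hU : ∀ Φ Ψ : Fin m → Fin k → Fin n × Bool, (∀ i ∉ U Φ, Ψ i = Φ i) → A Ψ = A Φ ∧ U Ψ = U Φ)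
    (hs : ∀ Φ, s ≤ (U Φ).card) (ε : ℝ) (hε : 0 < ε)
    (hsucc : ε * Fintype.card (Fin m → Fin k → Fin n × Bool) ≤
      ((univ : Finset (Fin m → Fin k → Fin n × Bool)).filter fun Φ =>
        ∀ i, ∃ j, A Φ (Φ i j).1 = (Φ i j).2).card) :
    (s : ℝ) ≤ 2 ^ k * Real.log (1 / ε) := by
  have hN : (0 : ℝ) < Fintype.card (Fin m → Fin k → Fin n × Bool) := by
    haveI : Nonempty (Fin n × Bool) := ⟨(⟨0, hn⟩, false)⟩
    exact_mod_cast Fintype.card_pos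
  have h := shwQ_card_solved_le A U s hU hs
  -- `ε ≤ (1 - 2^{-k})^s ≤ exp (-s/2^k)`
  have hεr : ε ≤ (1 - (1 / 2 : ℝ) ^ k) ^ s := le_of_mul_le_mul_right (hsucc.trans h) hN
  set p : ℝ := (1 / 2 : ℝ) ^ k with hp
  have hp0 : 0 < p := by positivity
  have hp1 : p ≤ 1 := pow_le_one₀ (by norm_num) (by norm_num)
  have hexp : (1 - p) ^ s ≤ Real.exp (-(p * s)) := by
    calc (1 - p) ^ s ≤ (Real.exp (-p)) ^ s :=
          pow_le_pow_left₀ (by linarith) (by linarith [Real.one_sub_le_exp_neg p]) s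
      _ = Real.exp (-(p * s)) := by rw [← Real.exp_nat_mul]; ring_nf
  have hle : ε ≤ Real.exp (-(p * s)) := hεr.trans hexp
  have hlog : Real.log ε ≤ -(p * s) := by
    have := Real.log_le_log hε hle
    rwa [Real.log_exp] at this
  have hps : p * s ≤ Real.log (1 / ε) := by
    rw [one_div, Real.log_inv]; linarith
  have h2p : (2 : ℝ) ^ k * p = 1 := by
    rw [hp, one_div, inv_pow, mul_inv_cancel₀ (by positivity)]
  calc (s : ℝ) = 2 ^ k * (p * s) := by rw [← mul_assoc, h2p, one_mul]
    _ ≤ 2 ^ k * Real.log (1 / ε) := mul_le_mul_of_nonneg_left hps (by positivity)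

end Adaptive

section Asymptotic

open Literature.Computability.Complexity

/-- `(1 - 2^{-k})^{s n} → 0` when `s n → ∞`. -/
theorem shwQ_tendsto_pow_unread (k : ℕ) {s : ℕ → ℕ} (hs : Tendsto s atTop atTop) :
    Tendsto (fun n => (1 - (1 / 2 : ℝ) ^ k) ^ s n) atTop (nhds 0) := by
  have h0 : (0 : ℝ) ≤ 1 - (1 / 2 : ℝ) ^ k :=
    sub_nonneg.2 (pow_le_one₀ (by norm_num) (by norm_num))
  have h1 : 1 - (1 / 2 : ℝ) ^ k < 1 := sub_lt_self _ (by positivity)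
  exact (tendsto_pow_atTop_nhds_zero_of_lt_one h0 h1).comp hs

/-- **Query rung, asymptotic form (abstract solvers, any `k`, any `α`).** A family of solvers
`A n m` each admitting a self-consistent unread structure with at least `s n → ∞` unread clauses
solves `F_k(n, ⌊αn⌋)` with probability `→ 0` (counting ratio eventually `≤ ε`). -/
theorem shwQ_ratio_eventually_le (k : ℕ) (α : ℝ) (s : ℕ → ℕ) (hs : Tendsto s atTop atTop)
    (A : (n m : ℕ) → (Fin m → Fin k → Fin n × Bool) → (Fin n → Bool))
    (hA : ∀ᶠ n : ℕ in atTop, ∀ m : ℕ, m = ⌊α * n⌋₊ →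
      ∃ U : (Fin m → Fin k → Fin n × Bool) → Finset (Fin m),
        (∀ Φ, s n ≤ (U Φ).card) ∧
        ∀ Φ Ψ : Fin m → Fin k → Fin n × Bool, (∀ i ∉ U Φ, Ψ i = Φ i) →
          A n m Ψ = A n m Φ ∧ U Ψ = U Φ)
    (ε : ℝ) (hε : 0 < ε) :
    ∀ᶠ n : ℕ in atTop, ∀ m : ℕ, m = ⌊α * n⌋₊ →
      (((univ : Finset (Fin m → Fin k → Fin n × Bool)).filter fun Φ =>
          ∀ i, ∃ j, A n m Φ (Φ i j).1 = (Φ i j).2).card : ℝ)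
        / Fintype.card (Fin m → Fin k → Fin n × Bool) ≤ ε := by
  filter_upwards [hA, (shwQ_tendsto_pow_unread k hs).eventually (ge_mem_nhds hε)]
    with n hn hsmall
  intro m hm
  obtain ⟨U, hsU, hU⟩ := hn m hm
  have h := shwQ_card_solved_le (A n m) U (s n) hU hsU
  rcases (Nat.cast_nonneg (α := ℝ) (Fintype.card (Fin m → Fin k → Fin n × Bool))).eq_or_lt
    with h0 | hpos
  · rw [← h0, div_zero]; exact hε.le
  · rw [div_le_iff₀ hpos]
    exact h.trans (mul_le_mul_of_nonneg_right hsmall (Nat.cast_nonneg _))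

/-- **Query rung for the crux's hardness conjunct (verbatim shape).** For ANY `f : List Bool →
List Bool` (no complexity hypothesis): if, eventually in `n`, the decoded assignment
`v ↦ (f ⌜Φ⌝).getD v false` on `F_k(n, ⌊αn⌋)` admits a self-consistent unread structure leaving at
least `s n → ∞` clauses unread, then `f` satisfies the hardness conjunct of `SearchHardWindow` at
`(k, α)`: its success ratio is eventually `≤ ε` for every `ε > 0`. -/
theorem shwQ_hardnessConjunct_of_unread (k : ℕ) (α : ℝ) (f : List Bool → List Bool)
    (s : ℕ → ℕ) (hs : Tendsto s atTop atTop)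
    (hf : ∀ᶠ n : ℕ in atTop, ∀ m : ℕ, m = ⌊α * n⌋₊ →
      ∃ U : (Fin m → Fin k → Fin n × Bool) → Finset (Fin m),
        (∀ Φ, s n ≤ (U Φ).card) ∧
        ∀ Φ Ψ : Fin m → Fin k → Fin n × Bool, (∀ i ∉ U Φ, Ψ i = Φ i) →
          (∀ v : Fin n,
            (f (encodingCNF.encode (List.ofFn fun a => List.ofFn fun b =>
                (((Ψ a b).1 : ℕ), (Ψ a b).2)))).getD v false
              = (f (encodingCNF.encode (List.ofFn fun a => List.ofFn fun b =>
                (((Φ a b).1 : ℕ), (Φ a b).2)))).getD v false) ∧ U Ψ = U Φ) :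
    ∀ ε : ℝ, 0 < ε → ∀ᶠ n : ℕ in Filter.atTop, ∀ m : ℕ, m = ⌊α * n⌋₊ →
      ((Finset.univ.filter fun Φ : Fin m → Fin k → Fin n × Bool => ∀ i, ∃ j,
          (f (Literature.Computability.Complexity.encodingCNF.encode (List.ofFn fun a =>
            List.ofFn fun b => (((Φ a b).1 : ℕ), (Φ a b).2)))).getD (Φ i j).1 false =
              (Φ i j).2).card : ℝ) / Fintype.card (Fin m → Fin k → Fin n × Bool) ≤ ε := by
  intro ε hε
  have key := shwQ_ratio_eventually_le k α s hs
    (fun n m Φ v => (f (encodingCNF.encode (List.ofFn fun a => List.ofFn fun b =>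
      (((Φ a b).1 : ℕ), (Φ a b).2)))).getD v false) ?_ ε hε
  · exact key
  · refine hf.mono fun n hn m hm => ?_
    obtain ⟨U, hsU, hU⟩ := hn m hm
    exact ⟨U, hsU, fun Φ Ψ h => ⟨funext fun v => (hU Φ Ψ h).1 v, (hU Φ Ψ h).2⟩⟩

/-- **Non-adaptive corollary.** If the decoded assignment of `f` depends only on the clauses at a
fixed set `R` of positions with `|R| + s n ≤ m`, `s n → ∞`, then `f` satisfies the hardness
conjunct of `SearchHardWindow` at `(k, α)`. -/
theorem shwQ_hardnessConjunct_of_nonadaptive (k : ℕ) (α : ℝ) (f : List Bool → List Bool)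
    (s : ℕ → ℕ) (hs : Tendsto s atTop atTop)
    (hf : ∀ᶠ n : ℕ in atTop, ∀ m : ℕ, m = ⌊α * n⌋₊ →
      ∃ R : Finset (Fin m), R.card + s n ≤ m ∧
        ∀ Φ Ψ : Fin m → Fin k → Fin n × Bool, (∀ i ∈ R, Ψ i = Φ i) → ∀ v : Fin n,
          (f (encodingCNF.encode (List.ofFn fun a => List.ofFn fun b =>
              (((Ψ a b).1 : ℕ), (Ψ a b).2)))).getD v false
            = (f (encodingCNF.encode (List.ofFn fun a => List.ofFn fun b =>
              (((Φ a b).1 : ℕ), (Φ a b).2)))).getD v false) :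
    ∀ ε : ℝ, 0 < ε → ∀ᶠ n : ℕ in Filter.atTop, ∀ m : ℕ, m = ⌊α * n⌋₊ →
      ((Finset.univ.filter fun Φ : Fin m → Fin k → Fin n × Bool => ∀ i, ∃ j,
          (f (Literature.Computability.Complexity.encodingCNF.encode (List.ofFn fun a =>
            List.ofFn fun b => (((Φ a b).1 : ℕ), (Φ a b).2)))).getD (Φ i j).1 false =
              (Φ i j).2).card : ℝ) / Fintype.card (Fin m → Fin k → Fin n × Bool) ≤ ε := by
  refine shwQ_hardnessConjunct_of_unread k α f s hs (hf.mono fun n hn m hm => ?_)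
  obtain ⟨R, hR, hdep⟩ := hn m hm
  refine ⟨fun _ => Rᶜ, fun _ => ?_, fun Φ Ψ h => ⟨hdep Φ Ψ fun i hi => h i ?_, rfl⟩⟩
  · rw [Finset.card_compl, Fintype.card_fin]; omega
  · rwa [Finset.mem_compl, not_not]

/-- **Oblivious corollary.** If `α > 0` and the decoded assignment of `f` does not depend on the
instance at all (e.g. `f` constant), then `f` satisfies the hardness conjunct of
`SearchHardWindow` at `(k, α)`, for every `k`. -/
theorem shwQ_hardnessConjunct_of_oblivious (k : ℕ) (α : ℝ) (hα : 0 < α)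
    (f : List Bool → List Bool)
    (hf : ∀ᶠ n : ℕ in atTop, ∀ m : ℕ, m = ⌊α * n⌋₊ →
        ∀ Φ Ψ : Fin m → Fin k → Fin n × Bool, ∀ v : Fin n,
          (f (encodingCNF.encode (List.ofFn fun a => List.ofFn fun b =>
              (((Ψ a b).1 : ℕ), (Ψ a b).2)))).getD v false
            = (f (encodingCNF.encode (List.ofFn fun a => List.ofFn fun b =>
              (((Φ a b).1 : ℕ), (Φ a b).2)))).getD v false) :
    ∀ ε : ℝ, 0 < ε → ∀ᶠ n : ℕ in Filter.atTop, ∀ m : ℕ, m = ⌊α * n⌋₊ →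
      ((Finset.univ.filter fun Φ : Fin m → Fin k → Fin n × Bool => ∀ i, ∃ j,
          (f (Literature.Computability.Complexity.encodingCNF.encode (List.ofFn fun a =>
            List.ofFn fun b => (((Φ a b).1 : ℕ), (Φ a b).2)))).getD (Φ i j).1 false =
              (Φ i j).2).card : ℝ) / Fintype.card (Fin m → Fin k → Fin n × Bool) ≤ ε := by
  have hs : Tendsto (fun n : ℕ => ⌊α * n⌋₊) atTop atTop :=
    tendsto_nat_floor_atTop.comp (Tendsto.const_mul_atTop hα tendsto_natCast_atTop_atTop)
  refine shwQ_hardnessConjunct_of_nonadaptive k α f (fun n => ⌊α * n⌋₊) hs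
    (hf.mono fun n hn m hm => ⟨∅, by simp [hm], fun Φ Ψ _ => hn m hm Φ Ψ⟩)

end Asymptotic

end Summit.PneNP.PneNP.Theorems
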